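import Summits.QuantumFields.YangMills.Theorems.UnitScaleTiltProp7CovCombMeanPoincare
import HarnessLib

/-!
# Route `UnitScaleTilt`, crux K1 «MinimiserStabilityRegPr» (stmt-QuantumFields-19200), route-R [RP] at a curved background — THE CURVED N6,
# ROW (R-B), PART 5: THE `hΛ`-SHAPED ASSEMBLY — `Σ_y ‖Λ_k(y)‖² ≤ c_Λ·(L^k/(√L−1)²)·[…]` FOR THE RECURSION OF RECORD ALONG THE BACKGROUND TOWER,
# MODULO THE TWO DISPLAYED PER-LEVEL ROWS (gradient growth `‖∇^{(j)}G_j‖² ≤ C_g·L^j·E`, mass `a_j²‖G_j‖² ≤ C_m·L^j·E′`)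

Cell `ym3-torus`, D-0154 (3c) R3 twin-width seat `ym-routeR-w2` (W-SEAT MAP pass #3 row M9: «(R-B) instantiation»; architecture «ℓ²-Minkowski over levels,
level-local», ★★OWNER g26 ACK 12).  Sixth file of the (R-B) chain; assembles ✓ `…CovIterLambdaBound` (Minkowski over the levels + tower regularity) with
✓ `…CovCombMeanPoincare` (the `ℓ²` size of the per-level comb term).  THEOREMS ONLY (0 `def`, 0 `sorry`); `--supports stmt-QuantumFields-19200`, count-neutral.
YM₃ on T³ is a ladder rung (R3), not the Clay problem; nothing here claims the curved N6 bound, S2, P, the crux or the gap.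

THE STATEMENT (★★ `sum_normSq_covIterLambda_le`).  Background `U₀ ∈ SU(N)` on the finest torus with `PlaqSmall (ε(L^k)⁻²) U₀` and the two numerical conditions of
[B7] Prop. 2; tower `Ū₀^{(j)} = Averaging.iter (blockAvg expMeanLogSU) j U₀`; families `G_j` (level-`j` bond fields) and `Λ_j` (coarse site functions) with `Λ_0 = 0` and
the recursion OF RECORD `Λ_{j+1}(z) = CM_j(G_j)(z) + Λ_j(emb z)` (✓ p606268 `Prop7TrueLinIterStructure`, `CM_j` = the covariant comb mean at `Ū₀^{(j)}` written out).
DISPLAYED per level `j < k`: (hgrad) `Σ_{b,ν} ‖Ū₀^{(j)}(b₋,ν)G_j(b+e_ν)Ū₀^{(j)}(b₋,ν)* − G_j(b)‖² ≤ C_g·L^j·E` (the one-step covariant gradient transfer through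
`G_{j+1} = LINE_j(G_j) + D_j`, ✓ p606243, iterated — FILE 3 of this chain) and (hmass) `(2ε(L^j/L^k)²)²·Σ_b‖G_j(b)‖² ≤ C_m·L^j·E′`.  THEN, for `k ≤ m + K`,
`Σ_y ‖Λ_k(y)‖² ≤ [(d+2)²N·L⁴·C_g·E + 4(d+2)²d³(3N+2d)·L⁶·C_m·E′]·L^k/(√L − 1)²` — the `hΛ` row of ✓ p601741 `Prop7CurvedLandauCoercivity` with
`c_Λ·G := [...]/(√L−1)²`, uniformly in the volume and in `k`.

HONEST SCOPE.  Assembly only; the two displayed rows are the remaining content of (R-B) (hgrad = FILE 3; hmass = the `ℓ²` mass of the reduced fields, flat scale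
`‖G_j‖² ~ L^{j(2−d)}‖Y‖²`).  Nothing of Bałaban's analysis is asserted beyond the cited tree theorems.

References: T. Bałaban, CMP 95 (1984) 17–40 [Balaban1984PropagatorsI] ((1.18)–(1.20) pp.19–20); CMP 98 (1985) 17–51 [Balaban1985Averaging] (Prop. 2 (53) p.26, (62) p.28);
CMP 99 (1985) 389–434 [Balaban1985BackgroundPropagators] (Thm 3.11 p.416).
-/

noncomputable section

open scoped BigOperators Matrix.Norms.L2Operator

namespace Summit.QuantumFields.YangMills.Theorems.Prop7CovIterLambdaEnergy

open Literature.MathematicalPhysics.QuantumFieldTheory.Balaban1983to89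
open Finset T4Continuum BlockAveraging AveragingRT ExpMeanLog BlockAveragingEMLLinearised BlockAveragingEMLLinearisedBackground BlockAveragingEMLProp2
open Summit.QuantumFields.YangMills.Theorems.Prop7CovIterLambdaBound (norm_le_of_rec_eq sum_normSq_le_geom tower_plaq_lt)
open Summit.QuantumFields.YangMills.Theorems.Prop7CovCombMeanPoincare (sum_normSq_covCombMean_le)

variable {N : ℕ} [NeZero N] {P : Params}

/-- **THE PER-LEVEL `ℓ²` SIZE IN GEOMETRIC FORM**: at a level-`j` background with plaquettes within `a` of `1`, if the covariant gradient energy of `X` is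
`≤ C_g·L^j·E` and `a²·Σ‖X‖² ≤ C_m·L^j·E′`, then `√(Σ_z ‖CM_j(X)(z)‖²) ≤ √([(d+2)²NL⁴C_gE + 4(d+2)²d³(3N+2d)L⁶C_mE′])·(√L)^j`.
[cite: Balaban1984PropagatorsI, (1.18)-(1.20) pp.19-20] -/
theorem sqrt_sum_normSq_covCombMean_le_geom {j : ℕ} (hj : j + 1 ≤ P.m + P.K) (V : GaugeField P j (Matrix.specialUnitaryGroup (Fin N) ℂ)) {a : ℝ}
    (ha : 0 ≤ a) (hV : ∀ q : Plaq P j, dist1 (GaugeField.plaqHol V q) ≤ a) (X : PBond P j → Matrix (Fin N) (Fin N) ℂ) {Cg Cm E E' : ℝ}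
    (hgrad : ∑ b : PBond P j, ∑ ν : Fin P.d,
        ‖((V ⟨b.src, ν⟩ : Matrix.specialUnitaryGroup (Fin N) ℂ) : Matrix (Fin N) (Fin N) ℂ) * X ⟨b.src.shift ν, b.dir⟩
            * star ((V ⟨b.src, ν⟩ : Matrix.specialUnitaryGroup (Fin N) ℂ) : Matrix (Fin N) (Fin N) ℂ) - X b‖ ^ 2 ≤ Cg * (P.L : ℝ) ^ j * E)
    (hmass : a ^ 2 * ∑ b : PBond P j, ‖X b‖ ^ 2 ≤ Cm * (P.L : ℝ) ^ j * E') :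
    Real.sqrt (∑ z : Site P (j + 1), ‖((Fintype.card (Idx P) : ℂ))⁻¹ • ∑ i : Idx P, covWalkSum V X (walk (emb z) (stairWord i.2.1 (off i.1)))‖ ^ 2)
      ≤ Real.sqrt (((P.d : ℝ) + 2) ^ 2 * N * (P.L : ℝ) ^ 4 * Cg * E + 4 * ((P.d : ℝ) + 2) ^ 2 * (P.d : ℝ) ^ 3 * (3 * N + 2 * P.d) * (P.L : ℝ) ^ 6 * Cm * E')
          * Real.sqrt P.L ^ j := by
  have hL0 : (0 : ℝ) ≤ (P.L : ℝ) := Nat.cast_nonneg _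
  have h := sum_normSq_covCombMean_le hj V ha hV X
  have hc1 : 0 ≤ ((P.d : ℝ) + 2) ^ 2 * N * (P.L : ℝ) ^ 4 := by positivity
  have hc2 : 0 ≤ 4 * ((P.d : ℝ) + 2) ^ 2 * (P.d : ℝ) ^ 3 * (3 * N + 2 * P.d) * (P.L : ℝ) ^ 6 := by positivity
  have h1 := mul_le_mul_of_nonneg_left hgrad hc1
  have h2 := mul_le_mul_of_nonneg_left hmass hc2
  have hbound : ∑ z : Site P (j + 1), ‖((Fintype.card (Idx P) : ℂ))⁻¹ • ∑ i : Idx P, covWalkSum V X (walk (emb z) (stairWord i.2.1 (off i.1)))‖ ^ 2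
      ≤ (((P.d : ℝ) + 2) ^ 2 * N * (P.L : ℝ) ^ 4 * Cg * E + 4 * ((P.d : ℝ) + 2) ^ 2 * (P.d : ℝ) ^ 3 * (3 * N + 2 * P.d) * (P.L : ℝ) ^ 6 * Cm * E')
          * (P.L : ℝ) ^ j := by
    have e2 : 4 * ((P.d : ℝ) + 2) ^ 2 * (P.d : ℝ) ^ 3 * (3 * N + 2 * P.d) * (P.L : ℝ) ^ 6 * a ^ 2 * ∑ b : PBond P j, ‖X b‖ ^ 2
        = 4 * ((P.d : ℝ) + 2) ^ 2 * (P.d : ℝ) ^ 3 * (3 * N + 2 * P.d) * (P.L : ℝ) ^ 6 * (a ^ 2 * ∑ b : PBond P j, ‖X b‖ ^ 2) := by ring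
    rw [e2] at h
    nlinarith [h, h1, h2]
  rw [← Real.sqrt_sq (pow_nonneg (Real.sqrt_nonneg _) j), ← Real.sqrt_mul']
  · refine Real.sqrt_le_sqrt (hbound.trans (le_of_eq ?_))
    rw [← pow_mul, mul_comm j 2, pow_mul, Real.sq_sqrt hL0]
  · positivity

/-- ★★ **(R-B) ASSEMBLED MODULO THE TWO DISPLAYED PER-LEVEL ROWS**: for the recursion of record `Λ_0 = 0`, `Λ_{j+1}(z) = CM_j(G_j)(z) + Λ_j(emb z)` along the
background tower of an `SU(N)` configuration with `PlaqSmall (ε(L^k)⁻²) U₀` ([B7] Prop. 2 regime), the displayed gradient-growth and mass rows give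
`Σ_y ‖Λ_k(y)‖² ≤ [(d+2)²N·L⁴·C_g·E + 4(d+2)²d³(3N+2d)·L⁶·C_m·E′]·L^k/(√L−1)²` (`k ≤ m + K`) — the `hΛ` row of the S2′ assembly, `c_Λ` uniform in the volume and in
`k`. [cite: Balaban1984PropagatorsI, (1.18)-(1.20) pp.19-20; Balaban1985Averaging, Prop. 2 (53) p.26, (62) p.28] -/
theorem sum_normSq_covIterLambda_le (k : ℕ) (hk : k ≤ P.m + P.K) (U₀ : GaugeField P 0 (Matrix.specialUnitaryGroup (Fin N) ℂ)) {ε : ℝ} (hε : 0 < ε)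
    (hε3 : (143 * ((((P.d + 4 : ℕ) : ℝ)) ^ 2 / 4) ^ 2) * ε ≤ 1 / 3)
    (hε2 : 2 * ε ≤ 2 * deltaSU (Fin N) / (((P.d + 4) * P.L : ℕ) : ℝ) ^ 2)
    (hU : PlaqSmall (ε * (((P.L : ℝ) ^ k)⁻¹) ^ 2) U₀)
    (G : (j : ℕ) → PBond P j → Matrix (Fin N) (Fin N) ℂ) (Λ : (j : ℕ) → Site P j → Matrix (Fin N) (Fin N) ℂ) (hΛ0 : ∀ y, Λ 0 y = 0)
    (hΛs : ∀ (j : ℕ) (z : Site P (j + 1)), Λ (j + 1) z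
      = ((Fintype.card (Idx P) : ℂ))⁻¹ • ∑ i : Idx P,
          covWalkSum (Averaging.iter (fun i => blockAvg (P := P) (j := i) (expMeanLogSU (n := Fin N))) j U₀) (G j)
            (walk (emb z) (stairWord i.2.1 (off i.1)))
        + Λ j (emb z))
    {Cg Cm E E' : ℝ} (hCg : 0 ≤ Cg) (hCm : 0 ≤ Cm) (hE : 0 ≤ E) (hE' : 0 ≤ E')
    (hgrad : ∀ j < k, ∑ b : PBond P j, ∑ ν : Fin P.d,
        ‖((Averaging.iter (fun i => blockAvg (P := P) (j := i) (expMeanLogSU (n := Fin N))) j U₀ ⟨b.src, ν⟩ : Matrix.specialUnitaryGroup (Fin N) ℂ) :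
              Matrix (Fin N) (Fin N) ℂ) * G j ⟨b.src.shift ν, b.dir⟩
            * star ((Averaging.iter (fun i => blockAvg (P := P) (j := i) (expMeanLogSU (n := Fin N))) j U₀ ⟨b.src, ν⟩ : Matrix.specialUnitaryGroup (Fin N) ℂ) :
              Matrix (Fin N) (Fin N) ℂ) - G j b‖ ^ 2 ≤ Cg * (P.L : ℝ) ^ j * E)
    (hmass : ∀ j < k, (2 * ε * ((P.L : ℝ) ^ j * ((P.L : ℝ) ^ k)⁻¹) ^ 2) ^ 2 * ∑ b : PBond P j, ‖G j b‖ ^ 2 ≤ Cm * (P.L : ℝ) ^ j * E') :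
    ∑ y : Site P k, ‖Λ k y‖ ^ 2
      ≤ (((P.d : ℝ) + 2) ^ 2 * N * (P.L : ℝ) ^ 4 * Cg * E + 4 * ((P.d : ℝ) + 2) ^ 2 * (P.d : ℝ) ^ 3 * (3 * N + 2 * P.d) * (P.L : ℝ) ^ 6 * Cm * E')
          * ((P.L : ℝ) ^ k / (Real.sqrt P.L - 1) ^ 2) := by
  -- the per-level terms
  set t : (j : ℕ) → Site P (j + 1) → ℝ := fun j z => ‖((Fintype.card (Idx P) : ℂ))⁻¹ • ∑ i : Idx P,
      covWalkSum (Averaging.iter (fun i => blockAvg (P := P) (j := i) (expMeanLogSU (n := Fin N))) j U₀) (G j)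
        (walk (emb z) (stairWord i.2.1 (off i.1)))‖ with htdef
  have ht0 : ∀ j z, 0 ≤ t j z := fun j z => norm_nonneg _
  have hrec : ∀ (j : ℕ) (z : Site P (j + 1)), ‖Λ (j + 1) z‖ ≤ t j z + ‖Λ j (emb z)‖ :=
    norm_le_of_rec_eq Λ (fun j z => ((Fintype.card (Idx P) : ℂ))⁻¹ • ∑ i : Idx P,
      covWalkSum (Averaging.iter (fun i => blockAvg (P := P) (j := i) (expMeanLogSU (n := Fin N))) j U₀) (G j)
        (walk (emb z) (stairWord i.2.1 (off i.1)))) hΛs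
  set R : ℝ := Real.sqrt (((P.d : ℝ) + 2) ^ 2 * N * (P.L : ℝ) ^ 4 * Cg * E
      + 4 * ((P.d : ℝ) + 2) ^ 2 * (P.d : ℝ) ^ 3 * (3 * N + 2 * P.d) * (P.L : ℝ) ^ 6 * Cm * E') with hR
  have hR0 : 0 ≤ R := Real.sqrt_nonneg _
  have hlev : ∀ j < k, Real.sqrt (∑ z : Site P (j + 1), t j z ^ 2) ≤ 1 * Real.sqrt P.L ^ j * R := by
    intro j hjk
    have hj : j + 1 ≤ P.m + P.K := by omega
    have ha : 0 ≤ 2 * ε * ((P.L : ℝ) ^ j * ((P.L : ℝ) ^ k)⁻¹) ^ 2 := by positivity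
    have hV : ∀ q : Plaq P j, dist1 (GaugeField.plaqHol (Averaging.iter (fun i => blockAvg (P := P) (j := i) (expMeanLogSU (n := Fin N))) j U₀) q)
        ≤ 2 * ε * ((P.L : ℝ) ^ j * ((P.L : ℝ) ^ k)⁻¹) ^ 2 := fun q => ((tower_plaq_lt k hε hε3 hε2 hU hjk.le q).1).le
    have h := sqrt_sum_normSq_covCombMean_le_geom hj _ ha hV (G j) (hgrad j hjk) (hmass j hjk)
    rw [one_mul, mul_comm]
    exact h
  have hmain := sum_normSq_le_geom Λ hΛ0 t ht0 hrec hk zero_le_one hR0 hlev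
  rw [one_pow, one_mul] at hmain
  refine hmain.trans (le_of_eq ?_)
  rw [hR, Real.sq_sqrt (by positivity)]
  ring

end Summit.QuantumFields.YangMills.Theorems.Prop7CovIterLambdaEnergy

end
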